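import Mathlib
import Literature.Analysis.FluidPDE.VectorCalculus
import Literature.Analysis.PDE.LoewnerNirenbergKelvin
import Summits.NavierStokesRegularity.NavierStokesRegularity.Theorems.ThreadingFluxCentreJetDefs
import Summits.NavierStokesRegularity.NavierStokesRegularity.Theorems.LandauTailHomSteadyProfileExistsCalculus
import Literature.Analysis.FluidPDE.AxisymGradientField
import Summits.NavierStokesRegularity.NavierStokesRegularity.Theorems.ThreadingFluxAzimuthalCartanDefs
import Summits.NavierStokesRegularity.NavierStokesRegularity.Theorems.ThreadingFluxAzimuthalCartanVertexWitnessGradient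
import Summits.NavierStokesRegularity.NavierStokesRegularity.Theorems.ThreadingFluxAzimuthalCartanVertexWitnessMirrorTilt
import HarnessLib

/-!
# Crux `PoloidalLiouville` (stmt-NavierStokesRegularity-1222, W1), crux idea «azimuthal-cartan-test» (ns-idea-15 g10, V26),
# V♯ `LandauVertexFlexibility`: the Laplacian of the witness potential — the linearised Liouville equation

The explicit V♯ witness (crux note `Cruxes/PoloidalLiouville/AzimuthalCartanVertexWitness.md`; bricks `…VertexWitness*.lean`) is
`δv = ∇θ + g·id` with `θ = (x₀² − x₁²)·(10r − 8x₂)/((r − x₂)²(2r − x₂))`, `g = 6θ/(2r − x₂)²`.  The one clause of V♯ not yet in the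
tree for it is `LinearisedSteadyNSOn landauTorus landau2 δv δp` (`div δv = 0` and the linearised momentum identity), verified exactly
outside Lean (`kb/symbolic_check.py`).  Its structural heart is the scalar identity proved here:

★ `laplacian_theta` — `Δθ = −6θ/(2r − x₂)²` off the axis ray, i.e. `Δθ = −g`: the LINEARISED LIOUVILLE EQUATION `r²Δθ + 2e^Φθ = 0`
(`θ` is the derivative of the Liouville potentials along Šverák's conformal family `f_ε = az + εz³` at the Landau flow `c = 2`).
★ `divergence_witness` — `div δv = 0` off the ray (`div(∇θ + g·id) = Δθ + Dg(x)x + 3g`, the first summand by `laplacian_theta`, the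
rest by the same clearing of denominators), and `divergence_witness_landauTorus` — the FIRST HALF of V♯'s `LinearisedSteadyNSOn` clause
BY NAME on `landauTorus`; the momentum identity is the remaining (L) computation of the same kind.

Method (reusable for the remaining identities): Mathlib's `Δ` as `Σᵢ ∂ᵢ∂ᵢ` (`laplacian_eq_sum_fderiv_fderiv_apply`), the explicit
first derivative of `θ` from `…VertexWitnessGradient.lean` as a local normal form `c₀v₀ + c₁v₁ + c₂v₂ + c₃⟪v, ·⟫` valid on the open
off-ray set, `HasFDerivAt` product/quotient chains for the coefficients, `field_simp`, and a `linear_combination` of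
`|x|² = x₀² + x₁² + x₂²` with an explicit polynomial multiplier.  Pure calculus about an explicit function; V♯, `PoloidalLiouville`
(1222), W1 and NS regularity stay OPEN / NOT proved.  `--supports stmt-NavierStokesRegularity-1222 --as helper`; 0 kit.  [folklore]
-/

-- the summit and its single problem share the name (D-0017 nested layout)
set_option linter.dupNamespace false

noncomputable section

open Set Function Metric
open scoped RealInnerProductSpace Topology Laplacian InnerProductSpace
open Literature.Analysis.FluidPDE
open Literature.Analysis.PDE.LoewnerNirenberg

namespace Summit.NavierStokesRegularity.NavierStokesRegularity.Theorems.PoloidalLiouville.AzimuthalCartan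

open Summit.NavierStokesRegularity.NavierStokesRegularity.Theorems.PoloidalLiouville.CentreJet (E3)
open Summit.NavierStokesRegularity.NavierStokesRegularity.Theorems.LandauTail (hasFDerivAt_norm_of_ne_zero)

namespace VertexWitness

set_option maxRecDepth 20000 in
/-- ★ **The linearised Liouville equation for the mode-2 potential**: off the axis ray,
`Δθ = −6θ/(2r − x₂)²` (`= −g`, the radial weight of the witness `δv = ∇θ + g·id`; equivalently `r²Δθ + 2e^Φθ = 0` with
`e^Φ = 3r²/(2r − x₂)²` the conformal factor of Landau's flow at `c = 2`).  Proof: `Δθ = Σᵢ ∂ᵢ(∂ᵢθ)` (`laplacian_eq_sum_fderiv_fderiv_apply`);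
near `x`, `∂ᵥθ(y) = c₀(y)v₀ + c₁(y)v₁ + c₂(y)v₂ + c₃(y)⟪v, y⟫` with explicit rational–radial coefficients (`fderiv_theta_apply`,
`fderiv_A_apply`); differentiate the coefficients once more by the product/quotient rules and clear denominators — the resulting
polynomial identity holds modulo `|x|² = x₀² + x₁² + x₂²` with an explicit multiplier. [folklore] -/
theorem laplacian_theta {x : E3} (hx : ‖x‖ ≠ x 2) :
    (Δ (fun y : E3 => ((y 0 ^ 2 - y 1 ^ 2) * (10 * ‖y‖ - 8 * y 2) / ((‖y‖ - y 2) ^ 2 * (2 * ‖y‖ - y 2)) : ℝ))) x =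
      -(6 * ((x 0 ^ 2 - x 1 ^ 2) * (10 * ‖x‖ - 8 * x 2) / ((‖x‖ - x 2) ^ 2 * (2 * ‖x‖ - x 2))) / (2 * ‖x‖ - x 2) ^ 2) := by
  have hle : x 2 ≤ ‖x‖ := (le_abs_self _).trans (by simpa using PiLp.norm_apply_le x 2)
  have h0 : x ≠ 0 := fun h => hx (by rw [h]; simp)
  have h1 : ‖x‖ - x 2 ≠ 0 := sub_ne_zero.2 hx
  have h2 : 2 * ‖x‖ - x 2 ≠ 0 := by
    intro h
    have : ‖x‖ = 0 := by linarith [norm_nonneg x]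
    rw [norm_eq_zero] at this
    exact hx (by rw [this]; simp)
  have hr0 : ‖x‖ ≠ 0 := norm_ne_zero_iff.2 h0
  have hM0 : (‖x‖ - x 2) ^ 2 * (2 * ‖x‖ - x 2) ≠ 0 := mul_ne_zero (pow_ne_zero 2 h1) h2
  -- the explicit first derivative `Dθ(y)v = c₀(y)v₀ + c₁(y)v₁ + c₂(y)v₂ + c₃(y)⟪v, y⟫` off the ray (local abbreviations)
  set Af : E3 → ℝ := fun y => (10 * ‖y‖ - 8 * y 2) / ((‖y‖ - y 2) ^ 2 * (2 * ‖y‖ - y 2)) with hAf_def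
  set al : E3 → ℝ := fun y => 10 * ((‖y‖ - y 2) ^ 2 * (2 * ‖y‖ - y 2))⁻¹ -
    (10 * ‖y‖ - 8 * y 2) * (((‖y‖ - y 2) ^ 2 * (2 * ‖y‖ - y 2)) ^ 2)⁻¹ *
      (2 * (‖y‖ - y 2) ^ 2 + 2 * ((2 * ‖y‖ - y 2) * (‖y‖ - y 2))) with hal_def
  set be : E3 → ℝ := fun y => -8 * ((‖y‖ - y 2) ^ 2 * (2 * ‖y‖ - y 2))⁻¹ +
    (10 * ‖y‖ - 8 * y 2) * (((‖y‖ - y 2) ^ 2 * (2 * ‖y‖ - y 2)) ^ 2)⁻¹ *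
      ((‖y‖ - y 2) ^ 2 + 2 * ((2 * ‖y‖ - y 2) * (‖y‖ - y 2))) with hbe_def
  set c0 : E3 → ℝ := fun y => 2 * Af y * y 0 with hc0_def
  set c1 : E3 → ℝ := fun y => -(2 * Af y * y 1) with hc1_def
  set c2 : E3 → ℝ := fun y => (y 0 ^ 2 - y 1 ^ 2) * be y with hc2_def
  set c3 : E3 → ℝ := fun y => (y 0 ^ 2 - y 1 ^ 2) * al y * ‖y‖⁻¹ with hc3_def
  have hLθ : ∀ {y : E3}, ‖y‖ ≠ y 2 → ∀ v : E3,
      fderiv ℝ (fun y : E3 => (y 0 ^ 2 - y 1 ^ 2) * (10 * ‖y‖ - 8 * y 2) / ((‖y‖ - y 2) ^ 2 * (2 * ‖y‖ - y 2))) y v =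
        c0 y * v 0 + c1 y * v 1 + c2 y * v 2 + c3 y * ⟪v, y⟫ := by
    intro y hy v
    rw [fderiv_theta_apply hy, fderiv_A_apply hy, real_inner_comm y v]
    simp only [hc0_def, hc1_def, hc2_def, hc3_def, hAf_def, hal_def, hbe_def]
    ring
  -- θ is C² at x
  have hn2 : ContDiffAt ℝ 2 (fun y : E3 => ‖y‖) x := contDiffAt_norm ℝ h0
  have hc2 : ∀ i : Fin 3, ContDiffAt ℝ 2 (fun y : E3 => y i) x := fun i =>
    (EuclideanSpace.proj i : E3 →L[ℝ] ℝ).contDiff.contDiffAt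
  have hθ2 : ContDiffAt ℝ 2 (fun y : E3 => (y 0 ^ 2 - y 1 ^ 2) * (10 * ‖y‖ - 8 * y 2) /
      ((‖y‖ - y 2) ^ 2 * (2 * ‖y‖ - y 2))) x :=
    ((((hc2 0).pow 2).sub ((hc2 1).pow 2)).mul ((contDiffAt_const.mul hn2).sub (contDiffAt_const.mul (hc2 2)))).div
      (((hn2.sub (hc2 2)).pow 2).mul ((contDiffAt_const.mul hn2).sub (hc2 2))) hM0
  have hD := differentiableAt_fderiv_of_contDiffAt hθ2
  rw [laplacian_eq_sum_fderiv_fderiv_apply hD (EuclideanSpace.basisFun (Fin 3) ℝ)]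
  have hopen : IsOpen {y : E3 | ‖y‖ ≠ y 2} :=
    isOpen_ne_fun continuous_norm (EuclideanSpace.proj (2 : Fin 3) : E3 →L[ℝ] ℝ).continuous
  have hev : ∀ v : E3, (fun y => fderiv ℝ (fun y : E3 => (y 0 ^ 2 - y 1 ^ 2) * (10 * ‖y‖ - 8 * y 2) /
      ((‖y‖ - y 2) ^ 2 * (2 * ‖y‖ - y 2))) y v) =ᶠ[𝓝 x]
      (fun y => c0 y * v 0 + c1 y * v 1 + c2 y * v 2 + c3 y * ⟪v, y⟫) := fun v => by
    filter_upwards [hopen.mem_nhds hx] with y hy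
    exact hLθ hy v
  -- first-order atoms at x and the derivative chains of the coefficients
  have hn : HasFDerivAt (fun y : E3 => ‖y‖) (‖x‖⁻¹ • (innerSL ℝ x : E3 →L[ℝ] ℝ)) x := hasFDerivAt_norm_of_ne_zero h0
  have hp : ∀ i : Fin 3, HasFDerivAt (fun y : E3 => y i) (EuclideanSpace.proj i : E3 →L[ℝ] ℝ) x := fun i =>
    (EuclideanSpace.proj i : E3 →L[ℝ] ℝ).hasFDerivAt
  have hN : HasFDerivAt (fun y : E3 => 10 * ‖y‖ - 8 * y 2) _ x := (hn.const_mul 10).sub ((hp 2).const_mul 8)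
  have hD1 : HasFDerivAt (fun y : E3 => ‖y‖ - y 2) _ x := hn.sub (hp 2)
  have hD2 : HasFDerivAt (fun y : E3 => 2 * ‖y‖ - y 2) _ x := (hn.const_mul 2).sub (hp 2)
  have hD1sq : HasFDerivAt (fun y : E3 => (‖y‖ - y 2) ^ 2) _ x :=
    (hD1.mul hD1).congr_of_eventuallyEq (Filter.Eventually.of_forall fun y => (sq (‖y‖ - y 2)))
  have hM : HasFDerivAt (fun y : E3 => (‖y‖ - y 2) ^ 2 * (2 * ‖y‖ - y 2)) _ x := hD1sq.mul hD2
  have hMinv : HasFDerivAt (fun y : E3 => ((‖y‖ - y 2) ^ 2 * (2 * ‖y‖ - y 2))⁻¹) _ x :=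
    (hasDerivAt_inv hM0).comp_hasFDerivAt x hM
  have hMsq : HasFDerivAt (fun y : E3 => ((‖y‖ - y 2) ^ 2 * (2 * ‖y‖ - y 2)) ^ 2) _ x :=
    (hM.mul hM).congr_of_eventuallyEq (Filter.Eventually.of_forall fun y => (sq _))
  have hM2inv : HasFDerivAt (fun y : E3 => (((‖y‖ - y 2) ^ 2 * (2 * ‖y‖ - y 2)) ^ 2)⁻¹) _ x :=
    (hasDerivAt_inv (pow_ne_zero 2 hM0)).comp_hasFDerivAt x hMsq
  have hninv : HasFDerivAt (fun y : E3 => ‖y‖⁻¹) _ x := (hasDerivAt_inv hr0).comp_hasFDerivAt x hn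
  have hQ : HasFDerivAt (fun y : E3 => y 0 ^ 2 - y 1 ^ 2) _ x :=
    (((hp 0).mul (hp 0)).congr_of_eventuallyEq (Filter.Eventually.of_forall fun y => (sq (y 0)))).sub
      (((hp 1).mul (hp 1)).congr_of_eventuallyEq (Filter.Eventually.of_forall fun y => (sq (y 1))))
  have hAf : HasFDerivAt Af _ x := hN.mul hMinv
  have hal : HasFDerivAt al _ x :=
    (hMinv.const_mul 10).sub ((hN.mul hM2inv).mul ((hD1sq.const_mul 2).add ((hD2.mul hD1).const_mul 2)))
  have hbe : HasFDerivAt be _ x :=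
    (hMinv.const_mul (-8)).add ((hN.mul hM2inv).mul (hD1sq.add ((hD2.mul hD1).const_mul 2)))
  have hc0 : HasFDerivAt c0 _ x := (hAf.const_mul 2).mul (hp 0)
  have hc1 : HasFDerivAt c1 _ x := ((hAf.const_mul 2).mul (hp 1)).neg
  have hc2' : HasFDerivAt c2 _ x := hQ.mul hbe
  have hc3 : HasFDerivAt c3 _ x := (hQ.mul hal).mul hninv
  have hsum : ∀ v : E3, HasFDerivAt (fun y => c0 y * v 0 + c1 y * v 1 + c2 y * v 2 + c3 y * ⟪v, y⟫) _ x := fun v =>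
    (((hc0.mul_const (v 0)).add (hc1.mul_const (v 1))).add (hc2'.mul_const (v 2))).add
      (hc3.mul ((innerSL ℝ v : E3 →L[ℝ] ℝ).hasFDerivAt))
  rw [Fin.sum_univ_three, (hev _).fderiv_eq, (hev _).fderiv_eq, (hev _).fderiv_eq, (hsum _).fderiv, (hsum _).fderiv,
    (hsum _).fderiv]
  simp only [EuclideanSpace.basisFun_apply, add_apply, smul_apply, sub_apply, neg_apply, smul_eq_mul, innerSL_apply_apply]
  have i0 : ⟪x, (EuclideanSpace.single 0 1 : E3)⟫ = x 0 := by rw [EuclideanSpace.inner_single_right]; simp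
  have i1 : ⟪x, (EuclideanSpace.single 1 1 : E3)⟫ = x 1 := by rw [EuclideanSpace.inner_single_right]; simp
  have i2 : ⟪x, (EuclideanSpace.single 2 1 : E3)⟫ = x 2 := by rw [EuclideanSpace.inner_single_right]; simp
  have j0 : ⟪(EuclideanSpace.single 0 1 : E3), x⟫ = x 0 := by rw [EuclideanSpace.inner_single_left]; simp
  have j1 : ⟪(EuclideanSpace.single 1 1 : E3), x⟫ = x 1 := by rw [EuclideanSpace.inner_single_left]; simp
  have j2 : ⟪(EuclideanSpace.single 2 1 : E3), x⟫ = x 2 := by rw [EuclideanSpace.inner_single_left]; simp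
  have s00 : ⟪(EuclideanSpace.single 0 1 : E3), (EuclideanSpace.single 0 1 : E3)⟫ = 1 := by
    rw [EuclideanSpace.inner_single_left]; simp
  have s11 : ⟪(EuclideanSpace.single 1 1 : E3), (EuclideanSpace.single 1 1 : E3)⟫ = 1 := by
    rw [EuclideanSpace.inner_single_left]; simp
  have s22 : ⟪(EuclideanSpace.single 2 1 : E3), (EuclideanSpace.single 2 1 : E3)⟫ = 1 := by
    rw [EuclideanSpace.inner_single_left]; simp
  have hpj : ∀ (i : Fin 3) (v : E3), (EuclideanSpace.proj i : E3 →L[ℝ] ℝ) v = v i := fun i v => rfl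
  simp only [i0, i1, i2, j0, j1, j2, s00, s11, s22, hpj, Pi.mul_apply, PiLp.single_apply]
  simp only [Fin.isValue, ↓reduceIte, Fin.reduceEq, hAf_def, hal_def, hbe_def, hc3_def, mul_zero, mul_one, zero_mul, add_zero,
    zero_add, sub_zero, zero_sub]
  clear hc0 hc1 hc2' hc3 hsum hAf hal hbe hQ hM2inv hMsq hMinv hM hD1sq hD1 hD2 hN hninv hev hD hθ2 hc2 hn2 hp hpj hn hLθ
    i0 i1 i2 j0 j1 j2 s00 s11 s22
  have hr2 : ‖x‖ ^ 2 = x 0 ^ 2 + x 1 ^ 2 + x 2 ^ 2 := by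
    rw [EuclideanSpace.norm_eq, Real.sq_sqrt (by positivity), Fin.sum_univ_three]
    simp only [Real.norm_eq_abs, sq_abs]
  set r := ‖x‖ with hrdef
  set a := x 0 with hadef
  set b := x 1 with hbdef
  set c := x 2 with hcdef
  field_simp
  linear_combination
    (-22 * a ^ 2 * c ^ 4 + 220 * a ^ 2 * c ^ 3 * r - 630 * a ^ 2 * c ^ 2 * r ^ 2 + 740 * a ^ 2 * c * r ^ 3
      - 320 * a ^ 2 * r ^ 4 + 22 * b ^ 2 * c ^ 4 - 220 * b ^ 2 * c ^ 3 * r + 630 * b ^ 2 * c ^ 2 * r ^ 2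
      - 740 * b ^ 2 * c * r ^ 3 + 320 * b ^ 2 * r ^ 4) * hr2

set_option maxRecDepth 20000 in
/-- ★ **The witness is divergence free off the ray**: `div(∇θ + g·id) = Δθ + Dg(x)x + 3g = −g − 2g + 3g = 0`
(`laplacian_theta` and Euler's relation for the `(−2)`-homogeneous weight `g`). [folklore] -/
theorem divergence_witness {x : E3} (hx : ‖x‖ ≠ x 2) :
    VectorCalculus.divergence (fun y : E3 =>
      gradient (fun y : E3 => (y 0 ^ 2 - y 1 ^ 2) * (10 * ‖y‖ - 8 * y 2) / ((‖y‖ - y 2) ^ 2 * (2 * ‖y‖ - y 2))) y +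
        (6 * ((y 0 ^ 2 - y 1 ^ 2) * (10 * ‖y‖ - 8 * y 2) / ((‖y‖ - y 2) ^ 2 * (2 * ‖y‖ - y 2))) / (2 * ‖y‖ - y 2) ^ 2) • y)
      x = 0 := by
  have hle : x 2 ≤ ‖x‖ := (le_abs_self _).trans (by simpa using PiLp.norm_apply_le x 2)
  have h0 : x ≠ 0 := fun h => hx (by rw [h]; simp)
  have h1 : ‖x‖ - x 2 ≠ 0 := sub_ne_zero.2 hx
  have h2 : 2 * ‖x‖ - x 2 ≠ 0 := by
    intro h
    have : ‖x‖ = 0 := by linarith [norm_nonneg x]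
    rw [norm_eq_zero] at this
    exact hx (by rw [this]; simp)
  have hr0 : ‖x‖ ≠ 0 := norm_ne_zero_iff.2 h0
  have hM0 : (‖x‖ - x 2) ^ 2 * (2 * ‖x‖ - x 2) ≠ 0 := mul_ne_zero (pow_ne_zero 2 h1) h2
  set θf : E3 → ℝ := fun y => (y 0 ^ 2 - y 1 ^ 2) * (10 * ‖y‖ - 8 * y 2) / ((‖y‖ - y 2) ^ 2 * (2 * ‖y‖ - y 2)) with hθf
  set gf : E3 → ℝ := fun y => 6 * ((y 0 ^ 2 - y 1 ^ 2) * (10 * ‖y‖ - 8 * y 2) / ((‖y‖ - y 2) ^ 2 * (2 * ‖y‖ - y 2))) /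
    (2 * ‖y‖ - y 2) ^ 2 with hgf
  -- smoothness
  have hn2 : ContDiffAt ℝ 2 (fun y : E3 => ‖y‖) x := contDiffAt_norm ℝ h0
  have hc2 : ∀ i : Fin 3, ContDiffAt ℝ 2 (fun y : E3 => y i) x := fun i =>
    (EuclideanSpace.proj i : E3 →L[ℝ] ℝ).contDiff.contDiffAt
  have hθ2 : ContDiffAt ℝ 2 θf x :=
    ((((hc2 0).pow 2).sub ((hc2 1).pow 2)).mul ((contDiffAt_const.mul hn2).sub (contDiffAt_const.mul (hc2 2)))).div
      (((hn2.sub (hc2 2)).pow 2).mul ((contDiffAt_const.mul hn2).sub (hc2 2))) hM0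
  have hD := differentiableAt_fderiv_of_contDiffAt hθ2
  have hG : DifferentiableAt ℝ (gradient θf) x := by
    have e : gradient θf = fun y => (InnerProductSpace.toDual ℝ E3).symm (fderiv ℝ θf y) := rfl
    rw [e]
    exact ((InnerProductSpace.toDual ℝ E3).symm.toContinuousLinearEquiv.contDiff.contDiffAt.comp x
      (hθ2.fderiv_right (m := 1) (by norm_num))).differentiableAt one_ne_zero
  -- first-order chains for g
  have hn : HasFDerivAt (fun y : E3 => ‖y‖) (‖x‖⁻¹ • (innerSL ℝ x : E3 →L[ℝ] ℝ)) x := hasFDerivAt_norm_of_ne_zero h0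
  have hp : ∀ i : Fin 3, HasFDerivAt (fun y : E3 => y i) (EuclideanSpace.proj i : E3 →L[ℝ] ℝ) x := fun i =>
    (EuclideanSpace.proj i : E3 →L[ℝ] ℝ).hasFDerivAt
  have hN : HasFDerivAt (fun y : E3 => 10 * ‖y‖ - 8 * y 2) _ x := (hn.const_mul 10).sub ((hp 2).const_mul 8)
  have hD1 : HasFDerivAt (fun y : E3 => ‖y‖ - y 2) _ x := hn.sub (hp 2)
  have hD2 : HasFDerivAt (fun y : E3 => 2 * ‖y‖ - y 2) _ x := (hn.const_mul 2).sub (hp 2)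
  have hD1sq : HasFDerivAt (fun y : E3 => (‖y‖ - y 2) ^ 2) _ x :=
    (hD1.mul hD1).congr_of_eventuallyEq (Filter.Eventually.of_forall fun y => (sq (‖y‖ - y 2)))
  have hD2sq : HasFDerivAt (fun y : E3 => (2 * ‖y‖ - y 2) ^ 2) _ x :=
    (hD2.mul hD2).congr_of_eventuallyEq (Filter.Eventually.of_forall fun y => (sq (2 * ‖y‖ - y 2)))
  have hM : HasFDerivAt (fun y : E3 => (‖y‖ - y 2) ^ 2 * (2 * ‖y‖ - y 2)) _ x := hD1sq.mul hD2
  have hMinv : HasFDerivAt (fun y : E3 => ((‖y‖ - y 2) ^ 2 * (2 * ‖y‖ - y 2))⁻¹) _ x :=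
    (hasDerivAt_inv hM0).comp_hasFDerivAt x hM
  have hm2inv : HasFDerivAt (fun y : E3 => ((2 * ‖y‖ - y 2) ^ 2)⁻¹) _ x :=
    (hasDerivAt_inv (pow_ne_zero 2 h2)).comp_hasFDerivAt x hD2sq
  have hQ : HasFDerivAt (fun y : E3 => y 0 ^ 2 - y 1 ^ 2) _ x :=
    (((hp 0).mul (hp 0)).congr_of_eventuallyEq (Filter.Eventually.of_forall fun y => (sq (y 0)))).sub
      (((hp 1).mul (hp 1)).congr_of_eventuallyEq (Filter.Eventually.of_forall fun y => (sq (y 1))))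
  have hg : HasFDerivAt gf _ x := (((hQ.mul hN).mul hMinv).const_mul 6).mul hm2inv
  -- the derivative of the witness at x
  have hδ : HasFDerivAt (fun y : E3 => gradient θf y + gf y • y) _ x := hG.hasFDerivAt.add (hg.smul (hasFDerivAt_id x))
  rw [divergence_eq_sum_inner_fderiv (EuclideanSpace.basisFun (Fin 3) ℝ), hδ.fderiv]
  -- the gradient part is the Laplacian
  have hcomp : ∀ i : Fin 3, ⟪(EuclideanSpace.basisFun (Fin 3) ℝ) i, fderiv ℝ (gradient θf) x ((EuclideanSpace.basisFun (Fin 3) ℝ) i)⟫ =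
      fderiv ℝ (fun y => fderiv ℝ θf y ((EuclideanSpace.basisFun (Fin 3) ℝ) i)) x ((EuclideanSpace.basisFun (Fin 3) ℝ) i) := by
    intro i
    rw [EuclideanSpace.basisFun_apply, EuclideanSpace.inner_single_left, map_one, one_mul]
    have h := ((EuclideanSpace.proj i : E3 →L[ℝ] ℝ).hasFDerivAt.comp x hG.hasFDerivAt).fderiv
    have e : ((EuclideanSpace.proj i : E3 →L[ℝ] ℝ) ∘ gradient θf) = fun y => fderiv ℝ θf y (EuclideanSpace.single i 1) := by
      funext y
      simp only [Function.comp_apply]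
      exact gradient_apply_eq_fderiv_single θf y i
    rw [e] at h
    rw [h]
    rfl
  have hlap : ∑ i : Fin 3, ⟪(EuclideanSpace.basisFun (Fin 3) ℝ) i,
      fderiv ℝ (gradient θf) x ((EuclideanSpace.basisFun (Fin 3) ℝ) i)⟫ = (Δ θf) x := by
    rw [laplacian_eq_sum_fderiv_fderiv_apply hD (EuclideanSpace.basisFun (Fin 3) ℝ)]
    exact Finset.sum_congr rfl fun i _ => hcomp i
  have hlapv : (Δ θf) x = -(6 * ((x 0 ^ 2 - x 1 ^ 2) * (10 * ‖x‖ - 8 * x 2) / ((‖x‖ - x 2) ^ 2 * (2 * ‖x‖ - x 2))) /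
      (2 * ‖x‖ - x 2) ^ 2) := laplacian_theta hx
  simp only [add_apply, smul_apply, ContinuousLinearMap.smulRight_apply, ContinuousLinearMap.id_apply, inner_add_right,
    Finset.sum_add_distrib, hlap, hlapv, inner_smul_right]
  rw [Fin.sum_univ_three, Fin.sum_univ_three]
  simp only [EuclideanSpace.basisFun_apply, add_apply, smul_apply, sub_apply, smul_eq_mul, innerSL_apply_apply]
  have i0 : ⟪x, (EuclideanSpace.single 0 1 : E3)⟫ = x 0 := by rw [EuclideanSpace.inner_single_right]; simp
  have i1 : ⟪x, (EuclideanSpace.single 1 1 : E3)⟫ = x 1 := by rw [EuclideanSpace.inner_single_right]; simp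
  have i2 : ⟪x, (EuclideanSpace.single 2 1 : E3)⟫ = x 2 := by rw [EuclideanSpace.inner_single_right]; simp
  have j0 : ⟪(EuclideanSpace.single 0 1 : E3), x⟫ = x 0 := by rw [EuclideanSpace.inner_single_left]; simp
  have j1 : ⟪(EuclideanSpace.single 1 1 : E3), x⟫ = x 1 := by rw [EuclideanSpace.inner_single_left]; simp
  have j2 : ⟪(EuclideanSpace.single 2 1 : E3), x⟫ = x 2 := by rw [EuclideanSpace.inner_single_left]; simp
  have s00 : ⟪(EuclideanSpace.single 0 1 : E3), (EuclideanSpace.single 0 1 : E3)⟫ = 1 := by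
    rw [EuclideanSpace.inner_single_left]; simp
  have s11 : ⟪(EuclideanSpace.single 1 1 : E3), (EuclideanSpace.single 1 1 : E3)⟫ = 1 := by
    rw [EuclideanSpace.inner_single_left]; simp
  have s22 : ⟪(EuclideanSpace.single 2 1 : E3), (EuclideanSpace.single 2 1 : E3)⟫ = 1 := by
    rw [EuclideanSpace.inner_single_left]; simp
  have hpj : ∀ (i : Fin 3) (v : E3), (EuclideanSpace.proj i : E3 →L[ℝ] ℝ) v = v i := fun i v => rfl
  simp only [i0, i1, i2, j0, j1, j2, s00, s11, s22, hpj, Pi.mul_apply, PiLp.single_apply]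
  simp only [Fin.isValue, ↓reduceIte, Fin.reduceEq, hgf, mul_zero, mul_one, add_zero, sub_zero, zero_sub]
  clear hcomp hlap hlapv hδ hg hQ hm2inv hMinv hM hD2sq hD1sq hD1 hD2 hN hp hn hG hD hθ2 hc2 hn2 hpj i0 i1 i2 j0 j1 j2 s00 s11 s22
  have hr2 : ‖x‖ ^ 2 = x 0 ^ 2 + x 1 ^ 2 + x 2 ^ 2 := by
    rw [EuclideanSpace.norm_eq, Real.sq_sqrt (by positivity), Fin.sum_univ_three]
    simp only [Real.norm_eq_abs, sq_abs]
  set r := ‖x‖ with hrdef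
  set a := x 0 with hadef
  set b := x 1 with hbdef
  set c := x 2 with hcdef
  field_simp
  linear_combination ((-(r * c ^ 3 * 8) + r ^ 2 * c ^ 2 * 24 - r ^ 3 * c * 32 + r ^ 4 * 16 + c ^ 4)⁻¹ *
    (324 * a ^ 2 * c ^ 2 - 780 * a ^ 2 * c * r + 480 * a ^ 2 * r ^ 2 - 324 * b ^ 2 * c ^ 2 + 780 * b ^ 2 * c * r - 480 * b ^ 2 * r ^ 2)) * hr2

/-- **First half of V♯'s `LinearisedSteadyNSOn landauTorus landau2 δv δp` for the explicit witness, BY NAME**: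
`∀ x ∈ landauTorus, div δv x = 0`. (The momentum half is NOT proved here; V♯, `PoloidalLiouville`, NS regularity stay OPEN.) [folklore] -/
theorem divergence_witness_landauTorus :
    ∀ x ∈ landauTorus, VectorCalculus.divergence (fun y : E3 =>
      gradient (fun y : E3 => (y 0 ^ 2 - y 1 ^ 2) * (10 * ‖y‖ - 8 * y 2) / ((‖y‖ - y 2) ^ 2 * (2 * ‖y‖ - y 2))) y +
        (6 * ((y 0 ^ 2 - y 1 ^ 2) * (10 * ‖y‖ - 8 * y 2) / ((‖y‖ - y 2) ^ 2 * (2 * ‖y‖ - y 2))) / (2 * ‖y‖ - y 2) ^ 2) • y)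
      x = 0 :=
  fun _ hx => divergence_witness (norm_ne_apply_two_of_mem_landauTorus hx)

end VertexWitness

end Summit.NavierStokesRegularity.NavierStokesRegularity.Theorems.PoloidalLiouville.AzimuthalCartan
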